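import Summits.ValiantsHypothesis.ValiantsHypothesis.Theorems.KPlusLogSqLawTridiagonalRealStaticLadderMoves

/-!
# Route «KPlusLogSqLaw», crux `WeakLifting` (stmt-ValiantsHypothesis-19561) — REAL side of the tridiagonal sector:
# the RUNG of the analytic ladder — two hierarchical edges add three certified sign alternations (sign-only invariant)

HONEST FRAMING.  Helper (`--supports stmt-ValiantsHypothesis-19561 --as helper`), seat val-sym-lift-p1 (g12), cell `pub-symmetroid`,
2026-08-27.  Pure real analysis on top of `…LadderMoves`.  The located LADDER of this lineage (memo ROTATING-DETECTOR-liftp1g11.md §3b: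
«after a rung whose second cut sits inside a tight pair, the next pair is again exploitable; every two fast edges add three zeros»)
is made a theorem WITHOUT locating zeros, by the following SIGN-ONLY INVARIANT («ladder state», written out as a conjunction — no definition) on two consecutive
continuants `q = D_{n−1}`, `p = D_n` (as real functions) and a sign `s = ±1`:
* a strictly increasing list `pre ++ ℓ :: γ :: suf` of positive sample points along which `p` ALTERNATES in sign (so `p` has at least
  `|pre| + |suf| + 1` positive zeros), with NO sample point strictly between `ℓ` and `γ`;
* structural points `ℓ < α < β < γ` with `p` of sign `s` at `ℓ, α, β` and `−s` at `γ`, `q` of sign `s` at `α` and `−s` at `β`;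
* the KEY clause: at every zero of `q` in `[α, β]` the sign of `p` is `s` (for continuants: `p = −W·(grandparent)` there).
`rung`: from such a state, two moves `h₁ = x·p − κ₁x^(2f₁)·q` (switch between `ℓ` and `α`) and `h₂ = x·h₁ − κ₂x^(2f₂)·p` (switch between a
split point `w₁ < β` and a fresh point `v' > β`), with `f₁, κ₁, f₂, κ₂` supplied by the even move lemma, produce a state for `(h₁, h₂, −s)` whose
sample list is `(pre ++ [ℓ]) ++ ℓ' :: w₁ :: v' :: γ :: suf` — THREE more alternations («fire, captured zero, fire» of the memo).  The two
split points `w₁` (first zero of `q` in `[α, β]`) and `w₂` (last zero of `h₁` in `[α, w₁]`) come from `exists_split_first/last`; the KEY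
clause propagates because `h₁ z = 0` forces `x·p z = κ₁ z^(2f₁) q z`.  Iterating from the size-3 base is the next file.
Nothing here is an upper bound; nothing bears on `WeakLifting` / `TropicalB` in their windows, Conjecture B, the doors, `MatrixDescartes`
(stmt-18050) or VP ≠ VNP.  [folklore: elementary real analysis; mechanism = this lineage's rotating-detector ladder]
-/

-- `Summit.ValiantsHypothesis.ValiantsHypothesis.…` repeats a component by the D-0017 layout (single-conjunct summit); the name is mandated.
set_option linter.dupNamespace false
set_option autoImplicit false

namespace Summit.ValiantsHypothesis.ValiantsHypothesis.Theorems.KPlusLogSqLaw.StaticTridiagonalRealLadder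

open Set Finset

/-! ### Sign bookkeeping (products with a fixed sign `t`) -/

/-- `a` has the sign of `b`, `b` has sign `t` ⇒ `a` has sign `t`. [folklore] -/
theorem sgn_of_mul_pos {a b t : ℝ} (h : 0 < a * b) (hb : 0 < t * b) : 0 < t * a := by
  rcases mul_pos_iff.mp h with ⟨ha, hb'⟩ | ⟨ha, hb'⟩
  · have ht : 0 < t := pos_of_mul_pos_left hb hb'.le
    exact mul_pos ht ha
  · have ht : t < 0 := by
      by_contra hcon; push Not at hcon; nlinarith
    nlinarith

/-- `a` has the sign of `−b`, `b` has sign `t` ⇒ `t·a < 0`. [folklore] -/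
theorem sgn_of_mul_neg {a b t : ℝ} (h : 0 < -(a * b)) (hb : 0 < t * b) : t * a < 0 := by
  have h' := sgn_of_mul_pos (a := -a) (b := b) (t := t) (by nlinarith) hb
  nlinarith

/-- opposite signs multiply to a negative number. [folklore] -/
theorem mul_neg_of_sgn {a b t : ℝ} (ha : 0 < t * a) (hb : t * b < 0) : a * b < 0 := by
  rcases mul_pos_iff.mp ha with ⟨ht, ha'⟩ | ⟨ht, ha'⟩
  · have hb' : b < 0 := by
      by_contra hcon; push Not at hcon; nlinarith
    exact mul_neg_of_pos_of_neg ha' hb'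
  · have hb' : 0 < b := by
      by_contra hcon; push Not at hcon; nlinarith
    exact mul_neg_of_neg_of_pos ha' hb'

/-- Along a list `pre ++ a :: b :: l` on which `f` alternates in sign, `f` vanishes nowhere. [folklore] -/
theorem ne_zero_of_isChain_alt_append {f : ℝ → ℝ} {a b : ℝ} {l : List ℝ} :
    ∀ {pre : List ℝ}, (pre ++ a :: b :: l).IsChain (fun x y => f x * f y < 0) → ∀ x ∈ pre ++ a :: b :: l, f x ≠ 0
  | [], h => by simpa using ne_zero_of_isChain_alt h
  | c :: pre, h => by
    intro x hx
    rw [List.cons_append] at h hx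
    rcases List.mem_cons.mp hx with rfl | hx
    · -- `c` is followed by the head of the nonempty list `pre ++ a :: b :: l`
      obtain ⟨d, rest, hd⟩ : ∃ d rest, pre ++ a :: b :: l = d :: rest := by
        cases pre with
        | nil => exact ⟨a, b :: l, rfl⟩
        | cons d pre => exact ⟨d, pre ++ a :: b :: l, rfl⟩
      rw [hd] at h
      have hcd : f x * f d < 0 := (List.isChain_cons_cons.mp h).1
      intro h0; rw [h0, zero_mul] at hcd; exact lt_irrefl _ hcd
    · exact ne_zero_of_isChain_alt_append (pre := pre) (List.isChain_cons.mp h).2 x hx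

/-! ### The invariant (written out; no definition is introduced)

THE LADDER STATE of `(q, p, s; pre, suf; ℓ, α, β, γ)` is the conjunction
`(s = 1 ∨ s = −1)` ∧ `pre ++ ℓ :: γ :: suf` strictly increasing ∧ positive ∧ `p` alternating along it ∧ `ℓ < α < β < γ`
∧ `s·p ℓ > 0` ∧ `s·p α > 0` ∧ `s·p β > 0` ∧ `s·p γ < 0` ∧ `s·q α > 0` ∧ `s·q β < 0` ∧ KEY `∀ z ∈ [α, β], q z = 0 → s·p z > 0`;
the rung takes its fourteen clauses as hypotheses and returns them, for the two new continuants, as one conjunction. -/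

/-! ### The rung -/

/-- **THE RUNG OF THE LADDER.**  From a ladder state for `(q, p, s)` there are two hierarchical edges — exponents `2f₁, 2f₂` and
coefficients `κ₁, κ₂ > 0` — such that the next two continuants `h₁ x = x·p x − κ₁x^(2f₁)·q x`, `h₂ x = x·h₁ x − κ₂x^(2f₂)·p x` are again in a ladder state,
for the sign `−s`, with sample list `(pre ++ [ℓ]) ++ ℓ' :: γ' :: (v' :: γ :: suf)`: three more entries, i.e. THREE MORE certified
alternations (+2 vertices, +3 zeros).  Proof = move (switch in `(ℓ, α)`), first-zero split of `q` on `[α, β]` at `w₁ = γ'`, move (switch in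
`(w₁, v')`), last-zero split of `h₁` on `[α, w₁]` at `w₂ = β'`, fresh point `ℓ'` left of `α`; all signs by `exists_move_signs_sq`.
[mechanism: this lineage's rotating-detector ladder, memo §3b; folklore analysis] -/
theorem rung {q p : ℝ → ℝ} (hq : Continuous q) (hp : Continuous p) {s : ℝ} {pre suf : List ℝ} {ℓ α β γ : ℝ}
    (hs : s = 1 ∨ s = -1) (hincr : (pre ++ ℓ :: γ :: suf).IsChain (· < ·)) (hpos : ∀ x ∈ pre ++ ℓ :: γ :: suf, 0 < x)
    (halt : (pre ++ ℓ :: γ :: suf).IsChain (fun x y => p x * p y < 0)) (hℓα : ℓ < α) (hαβ : α < β) (hβγ : β < γ)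
    (pℓ : 0 < s * p ℓ) (pα : 0 < s * p α) (pβ : 0 < s * p β) (pγ : s * p γ < 0) (qα : 0 < s * q α) (qβ : s * q β < 0)
    (key : ∀ z ∈ Icc α β, q z = 0 → 0 < s * p z) :
    ∃ (f₁ : ℕ) (κ₁ : ℝ) (f₂ : ℕ) (κ₂ : ℝ), 0 < κ₁ ∧ 0 < κ₂ ∧ ∃ ℓ' β' γ' v' : ℝ,
      ((-s = 1 ∨ -s = -1) ∧
      ((pre ++ [ℓ]) ++ ℓ' :: γ' :: v' :: γ :: suf).IsChain (· < ·) ∧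
      (∀ x ∈ (pre ++ [ℓ]) ++ ℓ' :: γ' :: v' :: γ :: suf, 0 < x) ∧
      ((pre ++ [ℓ]) ++ ℓ' :: γ' :: v' :: γ :: suf).IsChain (fun x y =>
        (x * (x * p x - κ₁ * x ^ (2 * f₁) * q x) - κ₂ * x ^ (2 * f₂) * p x) *
          (y * (y * p y - κ₁ * y ^ (2 * f₁) * q y) - κ₂ * y ^ (2 * f₂) * p y) < 0) ∧
      ℓ' < α ∧ α < β' ∧ β' < γ' ∧
      0 < -s * (ℓ' * (ℓ' * p ℓ' - κ₁ * ℓ' ^ (2 * f₁) * q ℓ') - κ₂ * ℓ' ^ (2 * f₂) * p ℓ') ∧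
      0 < -s * (α * (α * p α - κ₁ * α ^ (2 * f₁) * q α) - κ₂ * α ^ (2 * f₂) * p α) ∧
      0 < -s * (β' * (β' * p β' - κ₁ * β' ^ (2 * f₁) * q β') - κ₂ * β' ^ (2 * f₂) * p β') ∧
      -s * (γ' * (γ' * p γ' - κ₁ * γ' ^ (2 * f₁) * q γ') - κ₂ * γ' ^ (2 * f₂) * p γ') < 0 ∧
      0 < -s * (α * p α - κ₁ * α ^ (2 * f₁) * q α) ∧
      -s * (β' * p β' - κ₁ * β' ^ (2 * f₁) * q β') < 0 ∧
      (∀ z ∈ Icc α β', z * p z - κ₁ * z ^ (2 * f₁) * q z = 0 →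
        0 < -s * (z * (z * p z - κ₁ * z ^ (2 * f₁) * q z) - κ₂ * z ^ (2 * f₂) * p z))) := by
  -- unpack the old state
  have hsplit_incr := List.isChain_split.mp hincr      -- (pre ++ [ℓ]) and (ℓ :: γ :: suf)
  have hsplit_alt := List.isChain_split.mp halt
  have hℓγ : ℓ < γ := (List.isChain_cons_cons.mp hsplit_incr.2).1
  have hγsuf_incr : (γ :: suf).IsChain (· < ·) := (List.isChain_cons_cons.mp hsplit_incr.2).2
  have hγsuf_alt : (γ :: suf).IsChain (fun x y => p x * p y < 0) := (List.isChain_cons_cons.mp hsplit_alt.2).2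
  have hℓpos : 0 < ℓ := hpos ℓ (by simp)
  have hαpos : 0 < α := hℓpos.trans hℓα
  have hpre_lt : ∀ x ∈ pre, x < ℓ := by
    intro x hx
    have hpw := List.isChain_iff_pairwise.mp hsplit_incr.1
    exact List.pairwise_append.mp hpw |>.2.2 x hx ℓ (by simp)
  have hsuf_gt : ∀ y ∈ suf, γ < y := by
    intro y hy
    have hpw := List.isChain_iff_pairwise.mp hγsuf_incr
    exact (List.pairwise_cons.mp hpw).1 y hy
  have hp_ne : ∀ x ∈ pre ++ ℓ :: γ :: suf, p x ≠ 0 := ne_zero_of_isChain_alt_append halt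
  -- (1) a fresh point `v'` right of `β`: `p` of sign `s`, `q` of sign `−s`
  obtain ⟨v', ⟨hβv', hv'γ⟩, hpv', hqv'⟩ :=
    exists_point_right₂ hp hq (s := s) (t := -s) hβγ pβ (by linarith [qβ])
  have hv'pos : 0 < v' := (hαpos.trans hαβ).trans hβv'
  -- (2) MOVE 1: switch between `ℓ` and `α`
  obtain ⟨f₁, κ₁, hκ₁, hL₁, hR₁⟩ := exists_move_signs_sq (fun x => x * p x) q (pre ++ [ℓ]).toFinset ({α, v'} : Finset ℝ)
    hℓpos hℓα
    (by
      intro x hx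
      rw [List.mem_toFinset, List.mem_append, List.mem_singleton] at hx
      rcases hx with hx | rfl
      · have hxpos : 0 < x := hpos x (by simp [hx])
        exact ⟨hxpos, (hpre_lt x hx).le, mul_ne_zero hxpos.ne' (hp_ne x (by simp [hx]))⟩
      · exact ⟨hℓpos, le_rfl, mul_ne_zero hℓpos.ne' (hp_ne x (by simp))⟩)
    (by
      intro y hy
      rw [Finset.mem_insert, Finset.mem_singleton] at hy
      rcases hy with rfl | rfl
      · exact ⟨le_rfl, fun h0 => by have := qα; rw [h0, mul_zero] at this; exact lt_irrefl _ this⟩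
      · exact ⟨(hαβ.trans hβv').le, fun h0 => by rw [h0, mul_zero] at hqv'; exact lt_irrefl _ hqv'⟩)
  set h₁ : ℝ → ℝ := fun x => x * p x - κ₁ * x ^ (2 * f₁) * q x with hh₁def
  have hh₁ : Continuous h₁ := by rw [hh₁def]; fun_prop
  have h₁_eq : ∀ x, h₁ x = x * p x - κ₁ * x ^ (2 * f₁) * q x := fun x => rfl
  -- signs of `h₁`: like `p` on `pre ++ [ℓ]`, like `−q` at `α`, `v'`
  have h₁_left : ∀ x ∈ pre ++ [ℓ], 0 < h₁ x * p x := by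
    intro x hx
    have hxpos : 0 < x := by
      rcases List.mem_append.mp hx with hx | hx
      · exact hpos x (by simp [hx])
      · rw [List.mem_singleton] at hx; rw [hx]; exact hℓpos
    have := hL₁ x (List.mem_toFinset.mpr hx)
    rw [← h₁_eq] at this
    have e : (h₁ x) * (x * p x) = x * (h₁ x * p x) := by ring
    rw [e] at this
    exact pos_of_mul_pos_right this hxpos.le
  have h₁α : s * h₁ α < 0 := by
    have := hR₁ α (by simp)
    rw [← h₁_eq] at this
    exact sgn_of_mul_neg this qα
  have h₁v' : 0 < s * h₁ v' := by
    have := hR₁ v' (by simp)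
    rw [← h₁_eq] at this
    have := sgn_of_mul_neg this hqv'
    linarith
  have h₁ℓ : 0 < s * h₁ ℓ := sgn_of_mul_pos (h₁_left ℓ (by simp)) pℓ
  -- (3) SPLIT 1: first zero of `q` in `[α, β]`
  obtain ⟨w₁, ⟨hαw₁, hw₁β⟩, hq_w₁, hh₁w₁⟩ := exists_split_first hq hh₁ (s := s) (u := s) hαβ qα qβ
    (by
      intro z hz hqz
      rw [h₁_eq, hqz, mul_zero, sub_zero]
      have hzpos : 0 < z := hαpos.trans_le hz.1
      have := key z hz hqz
      nlinarith)
  have hw₁pos : 0 < w₁ := hαpos.trans hαw₁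
  have hw₁v' : w₁ < v' := hw₁β.trans hβv'
  -- (4) MOVE 2: switch between `w₁` and `v'`
  obtain ⟨f₂, κ₂, hκ₂, hL₂, hR₂⟩ := exists_move_signs_sq (fun x => x * h₁ x) p (pre ++ [ℓ, α, w₁]).toFinset
    (v' :: γ :: suf).toFinset hw₁pos hw₁v'
    (by
      intro x hx
      rw [List.mem_toFinset, List.mem_append] at hx
      rcases hx with hx | hx
      · have hxpos : 0 < x := hpos x (by simp [hx])
        refine ⟨hxpos, ((hpre_lt x hx).trans (hℓα.trans hαw₁)).le, mul_ne_zero hxpos.ne' ?_⟩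
        have := h₁_left x (by simp [hx])
        intro h0; rw [h0, zero_mul] at this; exact lt_irrefl _ this
      · simp only [List.mem_cons, List.not_mem_nil, or_false] at hx
        rcases hx with rfl | rfl | rfl
        · refine ⟨hℓpos, (hℓα.trans hαw₁).le, mul_ne_zero hℓpos.ne' ?_⟩
          intro h0; rw [h0, mul_zero] at h₁ℓ; exact lt_irrefl _ h₁ℓ
        · refine ⟨hαpos, hαw₁.le, mul_ne_zero hαpos.ne' ?_⟩
          intro h0; rw [h0, mul_zero] at h₁α; exact lt_irrefl _ h₁α
        · refine ⟨hw₁pos, le_rfl, mul_ne_zero hw₁pos.ne' ?_⟩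
          intro h0; rw [h0, mul_zero] at hh₁w₁; exact lt_irrefl _ hh₁w₁)
    (by
      intro y hy
      rw [List.mem_toFinset] at hy
      simp only [List.mem_cons] at hy
      rcases hy with rfl | rfl | hy
      · exact ⟨le_rfl, fun h0 => by rw [h0, mul_zero] at hpv'; exact lt_irrefl _ hpv'⟩
      · exact ⟨hv'γ.le, hp_ne y (by simp)⟩
      · exact ⟨(hv'γ.trans (hsuf_gt y hy)).le, hp_ne y (by simp [hy])⟩)
  set h₂ : ℝ → ℝ := fun x => x * h₁ x - κ₂ * x ^ (2 * f₂) * p x with hh₂def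
  have hh₂ : Continuous h₂ := by rw [hh₂def]; fun_prop
  have h₂_eq : ∀ x, h₂ x = x * h₁ x - κ₂ * x ^ (2 * f₂) * p x := fun x => rfl
  have h₂_left : ∀ x ∈ pre ++ [ℓ, α, w₁], 0 < h₂ x * h₁ x := by
    intro x hx
    have hxpos : 0 < x := by
      rcases List.mem_append.mp hx with hx | hx
      · exact hpos x (by simp [hx])
      · simp only [List.mem_cons, List.not_mem_nil, or_false] at hx
        rcases hx with rfl | rfl | rfl
        · exact hℓpos
        · exact hαpos
        · exact hw₁pos
    have := hL₂ x (List.mem_toFinset.mpr hx)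
    rw [← h₂_eq] at this
    have e : (h₂ x) * (x * h₁ x) = x * (h₂ x * h₁ x) := by ring
    rw [e] at this
    exact pos_of_mul_pos_right this hxpos.le
  have h₂_right : ∀ y ∈ v' :: γ :: suf, 0 < -(h₂ y * p y) := by
    intro y hy
    have := hR₂ y (List.mem_toFinset.mpr hy)
    rwa [← h₂_eq] at this
  have h₂α : s * h₂ α < 0 := by
    have := sgn_of_mul_pos (h₂_left α (by simp)) (show 0 < (-s) * h₁ α by linarith)
    linarith
  have h₂w₁ : 0 < s * h₂ w₁ := sgn_of_mul_pos (h₂_left w₁ (by simp)) hh₁w₁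
  have h₂v' : s * h₂ v' < 0 := sgn_of_mul_neg (h₂_right v' (by simp)) hpv'
  have h₂γ : 0 < s * h₂ γ := by
    have := sgn_of_mul_neg (h₂_right γ (by simp)) (show 0 < (-s) * p γ by linarith [pγ])
    linarith
  have h₂ℓ : 0 < s * h₂ ℓ := sgn_of_mul_pos (h₂_left ℓ (by simp)) h₁ℓ
  -- (5) SPLIT 2: last zero of `h₁` in `[α, w₁]`; KEY computation
  have hkey₂ : ∀ z ∈ Icc α w₁, h₁ z = 0 → 0 < (-s) * h₂ z := by
    intro z hz hz0
    have hzpos : 0 < z := hαpos.trans_le hz.1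
    have hqz : 0 < s * q z := hq_w₁ z hz
    -- `h₁ z = 0` forces `z·p z = κ₁ z^(2f₁) q z`, so `p z` has sign `s`
    have hpz : 0 < s * p z := by
      have e : z * p z = κ₁ * z ^ (2 * f₁) * q z := by
        have := h₁_eq z; rw [hz0] at this; linarith
      have : 0 < s * (z * p z) := by
        rw [e]
        have : s * (κ₁ * z ^ (2 * f₁) * q z) = (κ₁ * z ^ (2 * f₁)) * (s * q z) := by ring
        rw [this]; positivity
      have e2 : s * (z * p z) = z * (s * p z) := by ring
      rw [e2] at this
      exact pos_of_mul_pos_right this hzpos.le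
    rw [h₂_eq, hz0, mul_zero, zero_sub]
    have : -s * -(κ₂ * z ^ (2 * f₂) * p z) = (κ₂ * z ^ (2 * f₂)) * (s * p z) := by ring
    rw [this]; positivity
  obtain ⟨w₂, ⟨hαw₂, hw₂w₁⟩, hh₁_w₂, hh₂w₂⟩ := exists_split_last hh₁ hh₂ (t := s) (u := -s) hαw₁ h₁α hh₁w₁ hkey₂
  -- (6) a fresh point `ℓ'` left of `α` with `h₂` of sign `−s`
  obtain ⟨ℓ', ⟨hℓℓ', hℓ'α⟩, hh₂ℓ'⟩ := exists_point_left hh₂ (s := -s) hℓα (show 0 < (-s) * h₂ α by linarith)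
  -- (7) the new state
  refine ⟨f₁, κ₁, f₂, κ₂, hκ₁, hκ₂, ℓ', w₂, w₁, v', ?_⟩
  have hlist : (pre ++ [ℓ]) ++ ℓ' :: w₁ :: v' :: γ :: suf = pre ++ ℓ :: ℓ' :: w₁ :: v' :: γ :: suf := by simp
  show (-s = 1 ∨ -s = -1) ∧ ((pre ++ [ℓ]) ++ ℓ' :: w₁ :: v' :: γ :: suf).IsChain (· < ·) ∧
      (∀ x ∈ (pre ++ [ℓ]) ++ ℓ' :: w₁ :: v' :: γ :: suf, 0 < x) ∧
      ((pre ++ [ℓ]) ++ ℓ' :: w₁ :: v' :: γ :: suf).IsChain (fun x y => h₂ x * h₂ y < 0) ∧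
      ℓ' < α ∧ α < w₂ ∧ w₂ < w₁ ∧ 0 < -s * h₂ ℓ' ∧ 0 < -s * h₂ α ∧ 0 < -s * h₂ w₂ ∧ -s * h₂ w₁ < 0 ∧
      0 < -s * h₁ α ∧ -s * h₁ w₂ < 0 ∧ (∀ z ∈ Icc α w₂, h₁ z = 0 → 0 < -s * h₂ z)
  refine ⟨by rcases hs with h | h <;> simp [h], ?_, ?_, ?_, hℓ'α, hαw₂, hw₂w₁, hh₂ℓ', by linarith, hh₂w₂, by linarith,
    by linarith, by have := hh₁_w₂ w₂ ⟨le_rfl, hw₂w₁.le⟩; linarith,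
    fun z hz hz0 => hkey₂ z ⟨hz.1, hz.2.trans hw₂w₁.le⟩ hz0⟩
  · -- strictly increasing
    rw [hlist, List.isChain_split]
    refine ⟨hsplit_incr.1, ?_⟩
    simp only [List.isChain_cons_cons]
    exact ⟨hℓℓ', hℓ'α.trans (hαw₂.trans hw₂w₁), hw₁v', hv'γ, hγsuf_incr⟩
  · -- positive
    intro x hx
    rw [hlist, List.mem_append] at hx
    rcases hx with hx | hx
    · exact hpos x (by simp [hx])
    · simp only [List.mem_cons] at hx
      rcases hx with rfl | rfl | rfl | rfl | rfl | hx
      · exact hℓpos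
      · exact hℓpos.trans hℓℓ'
      · exact hw₁pos
      · exact hv'pos
      · exact hℓpos.trans hℓγ
      · exact hpos x (by simp [hx])
  · -- alternation of `h₂`
    rw [hlist, List.isChain_split]
    constructor
    · -- on `pre ++ [ℓ]`, `h₂` has the signs of `p`
      refine (isChain_alt_congr (c := 1) (f := p) (g := h₂) ?_).mp hsplit_alt.1
      intro x hx
      have h1 := h₁_left x hx
      have hx' : x ∈ pre ++ [ℓ, α, w₁] := by
        rcases List.mem_append.mp hx with hx | hx
        · simp [hx]
        · rw [List.mem_singleton] at hx; simp [hx]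
      have h2 := h₂_left x hx'
      have : 0 < (h₁ x * p x) * (h₂ x * h₁ x) := mul_pos h1 h2
      have e : (h₁ x * p x) * (h₂ x * h₁ x) = (h₁ x) ^ 2 * (p x * h₂ x) := by ring
      rw [e] at this
      rw [one_mul]
      exact pos_of_mul_pos_right this (sq_nonneg _)
    · simp only [List.isChain_cons_cons]
      refine ⟨mul_neg_of_sgn h₂ℓ (by linarith), ?_, mul_neg_of_sgn h₂w₁ h₂v', ?_, ?_⟩
      · exact mul_neg_of_sgn (t := -s) hh₂ℓ' (by linarith)
      · exact mul_neg_of_sgn (t := -s) (by linarith) (by linarith)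
      · -- on `γ :: suf`, `h₂` has the signs of `−p`
        refine (isChain_alt_congr (c := -1) (f := p) (g := h₂) ?_).mp hγsuf_alt
        intro x hx
        have := h₂_right x (by simp only [List.mem_cons] at hx ⊢; tauto)
        linarith

end Summit.ValiantsHypothesis.ValiantsHypothesis.Theorems.KPlusLogSqLaw.StaticTridiagonalRealLadder
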